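import Summits.ResolutionOfSingularities.ResolutionOfSingularities.Theorems.FrobeniusClosingPatchingRelPerfectCoreRungTowerCharts
import Literature.AlgebraicGeometry.Resolution.BlowupAlgebraStrictTransform
import Literature.AlgebraicGeometry.Resolution.BlowupAlgebraPresentation
import Literature.AlgebraicGeometry.Resolution.QuadraticTransformWeakTransform
import HarnessLib

/-!
# Crux `PatchingRelPerfect` (stmt-ResolutionOfSingularities-16161), chain w52 — programme r-d1,
# D1: the one-step DICTIONARY at layer `ℓ = 1` (ring level)

[OURS · L1 W5.2 · r-d1 D1] CRUX-PLAN v3.1 §6e «RING-LEVEL SPEC for D1» / §6f seat steer; the typed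
split `ChainW52TargetsD.lean` (`DictionaryPiece : Θ₃ → DepthOneConclusion`) consumes this file
affine-locally.  Data: ANY commutative ring `R` (an affine piece of `X_j`), `u ∈ R` (equation of
the regular hypersurface `E_j`), `z : Fin c → R` with `P = (u, z₁, …, z_c)` (the centre `C_j ⊂ E_j`,
pushed into `X_j`) and an ideal `𝔟 ≤ P` (a lift of `𝔟_j ⊆ 𝒪_{E_j}`, `C_j` inside its cosupport).
PROVED:

* S-SIDE (both chart models; no hypothesis on `R`):
  `DepthOne.map_span_sup_algebraMap_succ` / `…_chartBase_succ` — on the `z_i`-chart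
  `((u) + 𝔟) · R[P/z_i] = (z_i) · ((u′) + 𝔟′)` with `u′ = u/z_i` the strict transform of `E`'s
  equation and `𝔟′ = (𝔟 R[P/z_i] : z_i)` the CONTROLLED transform (`DepthOne.map_eq_span_mul_colon`:
  `𝔟 R[P/z_i] = (z_i) · 𝔟′`); `DepthOne.map_span_sup_algebraMap_zero` / `…_chartBase_zero` — on the
  `u`-chart `((u) + 𝔟) · R[P/u] = (u)` (the strict transform of `E` is empty there);
* E-SIDE (`P` quasi-regular and `R/P` a domain, i.e. the affine piece of the regular centre is
  integral): `DepthOne.exists_strictTransformEquiv` — a ring isomorphism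
  `Θ_i : R[P/z_i]/(u′) ≅ (R/(u))[P̄/z̄_i]` (the chart of `E_{j+1} = Bl_{C_j} E_j`) with `Θ_i(r) = r̄`
  and `Θ_i(z_j/z_i) = z̄_j/z̄_i` (tree `blowupAlgebra.quotientKerMapQuotientEquiv`: `z_i` is prime
  in `R[P/z_i]` by `blowupAlgebra.isPrime_span_algebraMap`, and `z_i ∤ u′` by the coefficient test
  `blowupAlgebra.eval_mem_span_algebraMap_iff`); `DepthOne.map_colon_eq_colon_map` — under any ring
  map `ψ : R[P/z_i] → (R/(u))[P̄/z̄_i]` over `R → R/(u)` (e.g. `Θ_i ∘ (mod u′)`) the controlled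
  transform `𝔟′` maps onto the E-side controlled transform `(𝔟̄ (R/(u))[P̄/z̄_i] : z̄_i)`, `𝔟̄ = 𝔟
  mod u` — the update `𝔟_j ↦ 𝔟_{j+1}` of `IsControlledSeq` read through `E_{j+1} = Bl_{C_j} E_j`.

Codimension-one centres (`P = (u, d)`: PEELING, D4) are included; for the record the `a`-fold peel
of one regular divisor `D = V(u, d) ⊂ E` is `isRegular_of_isBlowup_tower` (part 1) with `x = (u, d)`,
killed sub-family `{u}`.  Nothing here is a statement of the manuscript under review.

## References

* U. Görtz, T. Wedhorn, *Algebraic Geometry I* (2nd ed., 2020), Prop. 13.96 (2), p. 416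
  (strict transform of a closed subscheme). [GortzWedhorn2020]
* The Stacks Project, Tags 0804, 0BIQ, 080A. [StacksProject]
-/

-- `Summit.<Summit>.<Sub>.Theorems` with `Sub = Summit` (single-conjunct summit, D-0017)
set_option linter.dupNamespace false

noncomputable section

open CategoryTheory CategoryTheory.Limits AlgebraicGeometry Literature.AlgebraicGeometry.Resolution

namespace Summit.ResolutionOfSingularities.ResolutionOfSingularities.Theorems

universe u

namespace DepthOne

/-! ## Controlled transforms: colon ideals by a non-zero-divisor -/

/-- If `g` is a non-zero-divisor then `((g) · J : g) = J`. [folklore] -/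
theorem colon_span_singleton_mul_self {A : Type*} [CommRing A] {g : A} (hg : g ∈ nonZeroDivisors A)
    (J : Ideal A) : (Ideal.span {g} * J).colon {g} = J := by
  apply le_antisymm
  · intro x hx
    have hxg : x * g ∈ Ideal.span {g} * J := by
      have := Submodule.mem_colon.mp hx g rfl
      rwa [smul_eq_mul] at this
    obtain ⟨y, hy, hyx⟩ := Ideal.mem_span_singleton_mul.mp hxg
    have : x = y := by
      apply (mul_cancel_left_mem_nonZeroDivisors hg).mp
      rw [hyx, mul_comm]
    rw [this]; exact hy
  · intro y hy
    refine Submodule.mem_colon.mpr fun p hp => ?_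
    rw [Set.mem_singleton_iff] at hp
    rw [hp, smul_eq_mul, mul_comm y g]
    exact Ideal.mul_mem_mul (Ideal.mem_span_singleton_self g) hy

/-- **Transport of controlled transforms.** Let `ψ : A → A'` be a ring map, `J = (g) · J'` in `A`
(e.g. `J'` the controlled transform `(J : g)`) and `ψ g` a non-zero-divisor of `A'`.  Then the
controlled transform of `ψ(J) A'` by `ψ g` is `ψ(J') A'`. [folklore] -/
theorem colon_map_eq_map_of_eq_mul {A A' : Type*} [CommRing A] [CommRing A'] (ψ : A →+* A')
    {g : A} {J J' : Ideal A} (hJ : J = Ideal.span {g} * J') (hg : ψ g ∈ nonZeroDivisors A') :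
    (J.map ψ).colon {ψ g} = J'.map ψ := by
  rw [hJ, Ideal.map_mul, Ideal.map_span, Set.image_singleton]
  exact colon_span_singleton_mul_self hg _

/-! ## S-side chart identities (image model `R[P/a] ⊆ R[1/a]`) -/

section SSide

variable {R : Type u} [CommRing R] {c : ℕ} (u : R) (z : Fin c → R)

local notation3 "xx" => (Fin.cons u z : Fin (c + 1) → R)
local notation3 "P" => Ideal.span (Set.range (Fin.cons u z : Fin (c + 1) → R))

/-- `x_j = x_i · (x_j/x_i)` in `R[P/x_i]`. [cite: GortzWedhorn2020, (13.19) p. 415] -/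
theorem algebraMap_eq_mul_frac (i j : Fin (c + 1)) :
    algebraMap R (blowupAlgebra P (xx i)) (xx j) =
      algebraMap R (blowupAlgebra P (xx i)) (xx i) * blowupAlgebra.frac xx i j := by
  rw [blowupAlgebra.frac, blowupAlgebra.algebraMap_mul_gen]

/-- **Controlled transform**: for `𝔟 ≤ P`, `𝔟 · R[P/x_i] = (x_i) · (𝔟 R[P/x_i] : x_i)`.
[cite: StacksProject, Tag 0804] -/
theorem map_eq_span_mul_colon (i : Fin (c + 1)) {𝔟 : Ideal R} (h𝔟 : 𝔟 ≤ P) :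
    𝔟.map (algebraMap R (blowupAlgebra P (xx i))) =
      Ideal.span {algebraMap R (blowupAlgebra P (xx i)) (xx i)} *
        (𝔟.map (algebraMap R (blowupAlgebra P (xx i)))).colon
          {algebraMap R (blowupAlgebra P (xx i)) (xx i)} :=
  eq_span_singleton_mul_colon ((Ideal.map_mono h𝔟).trans
    (map_blowupAlgebra_eq_span (blowupAlgebra.mem_span_range xx i)).le)

/-- **D1, S-side, chart of `z_i`**: `((u) + 𝔟) · R[P/z_i] = (z_i) · ((u/z_i) + (𝔟 R[P/z_i] : z_i))`
— exceptional factor times (strict transform of `E` + controlled transform of `𝔟`); here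
`z_i = x_{i+1}` for `x = (u, z)`. [cite: GortzWedhorn2020, Prop. 13.96 (2)] [cite: StacksProject, Tag 0804] -/
theorem map_span_sup_algebraMap_succ (i : Fin c) {𝔟 : Ideal R} (h𝔟 : 𝔟 ≤ P) :
    (Ideal.span {u} ⊔ 𝔟).map (algebraMap R (blowupAlgebra P (xx (Fin.succ i)))) =
      Ideal.span {algebraMap R (blowupAlgebra P (xx (Fin.succ i))) (xx (Fin.succ i))} *
        (Ideal.span {blowupAlgebra.frac xx (Fin.succ i) 0} ⊔
          (𝔟.map (algebraMap R (blowupAlgebra P (xx (Fin.succ i))))).colon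
            {algebraMap R (blowupAlgebra P (xx (Fin.succ i))) (xx (Fin.succ i))}) := by
  have hu : algebraMap R (blowupAlgebra P (xx (Fin.succ i))) u =
      algebraMap R (blowupAlgebra P (xx (Fin.succ i))) (xx (Fin.succ i)) *
        blowupAlgebra.frac xx (Fin.succ i) 0 :=
    algebraMap_eq_mul_frac u z (Fin.succ i) 0
  conv_lhs => rw [Ideal.map_sup, Ideal.map_span, Set.image_singleton, hu,
    ← Ideal.span_singleton_mul_span_singleton, map_eq_span_mul_colon u z (Fin.succ i) h𝔟]
  rw [← Ideal.mul_sup]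

/-- **D1, S-side, chart of `u`**: `((u) + 𝔟) · R[P/u] = (u)` — the strict transform of `E` does not
meet this chart. [cite: StacksProject, Tag 0804] -/
theorem map_span_sup_algebraMap_zero {𝔟 : Ideal R} (h𝔟 : 𝔟 ≤ P) :
    (Ideal.span {u} ⊔ 𝔟).map (algebraMap R (blowupAlgebra P (xx 0))) =
      Ideal.span {algebraMap R (blowupAlgebra P (xx 0)) (xx 0)} := by
  have hP : (P).map (algebraMap R (blowupAlgebra P (xx 0))) =
      Ideal.span {algebraMap R (blowupAlgebra P (xx 0)) (xx 0)} :=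
    map_blowupAlgebra_eq_span (blowupAlgebra.mem_span_range xx 0)
  apply le_antisymm
  · rw [← hP]
    exact Ideal.map_mono (sup_le (Ideal.span_le.mpr (Set.singleton_subset_iff.mpr
      (Ideal.mem_span_range_self (f := xx) (x := 0)))) h𝔟)
  · rw [Ideal.map_sup, Ideal.map_span, Set.image_singleton]
    exact le_sup_left

/-! ### The same identities in the `Proj` chart model `(R[Pt])_{(x_i t)}` -/

/-- **Controlled transform (chart ring)**: `𝔟 · B_i = (x_i) · (𝔟 B_i : x_i)` for `𝔟 ≤ P`.
[cite: StacksProject, Tag 0804] -/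
theorem map_chartBase_eq_span_mul_colon (i : Fin (c + 1)) {𝔟 : Ideal R} (h𝔟 : 𝔟 ≤ P) :
    𝔟.map (chartBase xx i) = Ideal.span {chartBase xx i (xx i)} *
      (𝔟.map (chartBase xx i)).colon {chartBase xx i (xx i)} :=
  eq_span_singleton_mul_colon ((Ideal.map_mono h𝔟).trans
    (map_reesChartBase_eq (xx i) (Ideal.mem_span_range_self (f := xx) (x := i))).le)

/-- **D1, S-side, chart ring of `z_i`**: `((u) + 𝔟) · B = (z_i) · ((e_u) + (𝔟 B : z_i))`.
[cite: GortzWedhorn2020, Prop. 13.96 (2)] [cite: StacksProject, Tag 0804] -/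
theorem map_span_sup_chartBase_succ (i : Fin c) {𝔟 : Ideal R} (h𝔟 : 𝔟 ≤ P) :
    (Ideal.span {u} ⊔ 𝔟).map (chartBase xx (Fin.succ i)) =
      Ideal.span {chartBase xx (Fin.succ i) (xx (Fin.succ i))} *
        (Ideal.span {chartGen xx (Fin.succ i) 0} ⊔
          (𝔟.map (chartBase xx (Fin.succ i))).colon {chartBase xx (Fin.succ i) (xx (Fin.succ i))}) := by
  have hu : chartBase xx (Fin.succ i) u =
      chartBase xx (Fin.succ i) (xx (Fin.succ i)) * chartGen xx (Fin.succ i) 0 :=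
    reesChartBase_apply_eq_mul_chartGen xx (Fin.succ i) 0
  conv_lhs => rw [Ideal.map_sup, Ideal.map_span, Set.image_singleton, hu,
    ← Ideal.span_singleton_mul_span_singleton, map_chartBase_eq_span_mul_colon u z (Fin.succ i) h𝔟]
  rw [← Ideal.mul_sup]

/-- **D1, S-side, chart ring of `u`**: `((u) + 𝔟) · B₀ = (u)`. [cite: StacksProject, Tag 0804] -/
theorem map_span_sup_chartBase_zero {𝔟 : Ideal R} (h𝔟 : 𝔟 ≤ P) :
    (Ideal.span {u} ⊔ 𝔟).map (chartBase xx 0) = Ideal.span {chartBase xx 0 (xx 0)} := by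
  have hP : (P).map (chartBase xx 0) = Ideal.span {chartBase xx 0 (xx 0)} :=
    map_reesChartBase_eq (xx 0) (Ideal.mem_span_range_self (f := xx) (x := 0))
  apply le_antisymm
  · rw [← hP]
    exact Ideal.map_mono (sup_le (Ideal.span_le.mpr (Set.singleton_subset_iff.mpr
      (Ideal.mem_span_range_self (f := xx) (x := 0)))) h𝔟)
  · rw [Ideal.map_sup, Ideal.map_span, Set.image_singleton]
    exact le_sup_left

end SSide

/-! ## E-side: the strict transform of `E` is the blow-up of `E` along the centre -/

section ESide

variable {R : Type u} [CommRing R] {c : ℕ} (u : R) (z : Fin c → R)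

local notation3 "xx" => (Fin.cons u z : Fin (c + 1) → R)
local notation3 "P" => Ideal.span (Set.range (Fin.cons u z : Fin (c + 1) → R))
local notation3 "zb" => fun j : Fin c => Ideal.Quotient.mk (Ideal.span {u}) (z j)

/-- The centre of `E = Spec R/(u)` below `P`: `P · (R/(u)) = (z̄₁, …, z̄_c)`. [folklore] -/
theorem map_mk_span_cons :
    (P).map (Ideal.Quotient.mk (Ideal.span {u})) = Ideal.span (Set.range zb) := by
  rw [Ideal.map_span, Fin.range_cons, Set.image_insert_eq, ← Set.range_comp,
    Ideal.Quotient.eq_zero_iff_mem.mpr (Ideal.mem_span_singleton_self u), Ideal.span_insert,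
    Ideal.span_singleton_eq_bot.mpr rfl, bot_sup_eq]
  rfl

/-- **D1, E-side: `R[P/z_i]/(u/z_i) ≅ (R/(u))[P̄/z̄_i]`** — the strict transform `V(u/z_i)` of
`E = V(u)` on the `z_i`-chart of `Bl_P Spec R` IS the `z̄_i`-chart of `Bl_{P̄} E`, for `P`
quasi-regular with `R/P` a domain; the isomorphism sends `r ↦ r̄` and `z_j/z_i ↦ z̄_j/z̄_i`.
(Tree: `blowupAlgebra.quotientKerMapQuotientEquiv`; `z_i` is prime in `R[P/z_i]` because
`R[P/z_i]/(z_i) ≅ (R/P)[T]`, and `z_i ∤ u/z_i` by the coefficient test.)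
[cite: GortzWedhorn2020, Prop. 13.96 (2), p. 416] [cite: StacksProject, Tag 0BIQ] -/
theorem exists_strictTransformEquiv (hx : IsQuasiRegular xx) [IsDomain (R ⧸ P)] (i : Fin c) :
    ∃ Θ : (blowupAlgebra P (xx (Fin.succ i)) ⧸ Ideal.span {blowupAlgebra.frac xx (Fin.succ i) 0}) ≃+*
        blowupAlgebra (Ideal.span (Set.range zb)) (Ideal.Quotient.mk (Ideal.span {u}) (z i)),
      (∀ r : R, Θ (Ideal.Quotient.mk _ (algebraMap R (blowupAlgebra P (xx (Fin.succ i))) r)) =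
        algebraMap (R ⧸ Ideal.span {u}) _ (Ideal.Quotient.mk (Ideal.span {u}) r)) ∧
      (∀ j : Fin c, Θ (Ideal.Quotient.mk _ (blowupAlgebra.frac xx (Fin.succ i) (Fin.succ j))) =
        blowupAlgebra.frac zb i j) := by
  classical
  -- the three inputs of the tree's strict-transform isomorphism
  have hf : algebraMap R (blowupAlgebra P (xx (Fin.succ i))) u =
      algebraMap R (blowupAlgebra P (xx (Fin.succ i))) (xx (Fin.succ i)) ^ 1 *
        blowupAlgebra.frac xx (Fin.succ i) 0 := by
    rw [pow_one]; exact algebraMap_eq_mul_frac u z (Fin.succ i) 0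
  have hP1 : (1 : R) ∉ P := fun h =>
    one_ne_zero (Ideal.Quotient.eq_zero_iff_mem.mpr h : (1 : R ⧸ P) = 0)
  haveI hprimeI := blowupAlgebra.isPrime_span_algebraMap xx (Fin.succ i) hx
  have hne : algebraMap R (blowupAlgebra P (xx (Fin.succ i))) (xx (Fin.succ i)) ≠ 0 := by
    intro h0
    have hnzd := algebraMap_mem_nonZeroDivisors_blowupAlgebra (I := P) (a := xx (Fin.succ i))
    rw [h0] at hnzd
    have hall : ∀ a : blowupAlgebra P (xx (Fin.succ i)), a = 0 := fun a =>
      (mem_nonZeroDivisors_iff.mp hnzd).2 a (mul_zero a)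
    exact hprimeI.ne_top ((Ideal.eq_top_iff_one _).mpr (by rw [hall 1]; exact Ideal.zero_mem _))
  have hprime : Prime (algebraMap R (blowupAlgebra P (xx (Fin.succ i))) (xx (Fin.succ i))) :=
    (Ideal.span_singleton_prime hne).mp hprimeI
  have hndvd : ¬ algebraMap R (blowupAlgebra P (xx (Fin.succ i))) (xx (Fin.succ i)) ∣
      blowupAlgebra.frac xx (Fin.succ i) 0 := by
    intro hdvd
    have hmem : blowupAlgebra.eval xx (Fin.succ i) (MvPolynomial.X ⟨0, (Fin.succ_ne_zero i).symm⟩) ∈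
        Ideal.span {algebraMap R (blowupAlgebra P (xx (Fin.succ i))) (xx (Fin.succ i))} := by
      rw [blowupAlgebra.eval_X]
      exact Ideal.mem_span_singleton.mpr hdvd
    have h := (blowupAlgebra.eval_mem_span_algebraMap_iff xx (Fin.succ i) hx _).mp hmem
      (Finsupp.single ⟨0, (Fin.succ_ne_zero i).symm⟩ 1)
    rw [MvPolynomial.coeff_X, if_pos rfl] at h
    exact hP1 h
  let Θ₀ := blowupAlgebra.quotientKerMapQuotientEquiv P (xx (Fin.succ i)) hf hprime hndvd
  -- re-target along `P (R/(u)) = (z̄)`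
  have hI : blowupAlgebra ((P).map (Ideal.Quotient.mk (Ideal.span {u})))
      (Ideal.Quotient.mk (Ideal.span {u}) (xx (Fin.succ i))) =
      blowupAlgebra (Ideal.span (Set.range zb)) (Ideal.Quotient.mk (Ideal.span {u}) (z i)) := by
    rw [map_mk_span_cons]; rfl
  let ε := Subalgebra.equivOfEq _ _ hI
  refine ⟨Θ₀.trans ε.toRingEquiv, fun r => ?_, fun j => ?_⟩
  · apply Subtype.ext
    rw [RingEquiv.trans_apply, blowupAlgebra.quotientKerMapQuotientEquiv_mk,
      blowupAlgebra.mapQuotient_algebraMap]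
    rfl
  · apply Subtype.ext
    rw [RingEquiv.trans_apply, blowupAlgebra.quotientKerMapQuotientEquiv_mk, blowupAlgebra.frac,
      blowupAlgebra.mapQuotient_gen]
    rfl

/-- **D1, E-side: controlled transforms correspond.** For every ring map
`ψ : R[P/z_i] → (R/(u))[P̄/z̄_i]` over `R → R/(u)` (e.g. `Θ_i ∘ (mod u/z_i)`) and every `𝔟 ≤ P`, the
controlled transform `(𝔟 R[P/z_i] : z_i)` is carried onto the E-side controlled transform
`(𝔟̄ (R/(u))[P̄/z̄_i] : z̄_i)`, `𝔟̄ = 𝔟 (R/(u))` — the update `𝔟_j ↦ 𝔟_{j+1}` of a controlled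
sequence, read on the strict transform `E_{j+1} = Bl_{C_j} E_j`. [cite: GortzWedhorn2020, Prop. 13.96 (2)] -/
theorem map_colon_eq_colon_map (i : Fin c)
    (ψ : blowupAlgebra P (xx (Fin.succ i)) →+*
      blowupAlgebra (Ideal.span (Set.range zb)) (Ideal.Quotient.mk (Ideal.span {u}) (z i)))
    (hψ : ∀ r : R, ψ (algebraMap R (blowupAlgebra P (xx (Fin.succ i))) r) =
      algebraMap (R ⧸ Ideal.span {u}) _ (Ideal.Quotient.mk (Ideal.span {u}) r))
    {𝔟 : Ideal R} (h𝔟 : 𝔟 ≤ P) :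
    ((𝔟.map (algebraMap R (blowupAlgebra P (xx (Fin.succ i))))).colon
        {algebraMap R (blowupAlgebra P (xx (Fin.succ i))) (xx (Fin.succ i))}).map ψ =
      ((𝔟.map (Ideal.Quotient.mk (Ideal.span {u}))).map (algebraMap (R ⧸ Ideal.span {u})
          (blowupAlgebra (Ideal.span (Set.range zb)) (Ideal.Quotient.mk (Ideal.span {u}) (z i))))).colon
        {algebraMap (R ⧸ Ideal.span {u}) (blowupAlgebra (Ideal.span (Set.range zb))
          (Ideal.Quotient.mk (Ideal.span {u}) (z i))) (Ideal.Quotient.mk (Ideal.span {u}) (z i))} := by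
  have hcomp : ψ.comp (algebraMap R (blowupAlgebra P (xx (Fin.succ i)))) =
      (algebraMap (R ⧸ Ideal.span {u}) (blowupAlgebra (Ideal.span (Set.range zb))
        (Ideal.Quotient.mk (Ideal.span {u}) (z i)))).comp (Ideal.Quotient.mk (Ideal.span {u})) :=
    RingHom.ext fun r => hψ r
  have h𝔟map : (𝔟.map (algebraMap R (blowupAlgebra P (xx (Fin.succ i))))).map ψ =
      (𝔟.map (Ideal.Quotient.mk (Ideal.span {u}))).map (algebraMap (R ⧸ Ideal.span {u})
        (blowupAlgebra (Ideal.span (Set.range zb)) (Ideal.Quotient.mk (Ideal.span {u}) (z i)))) := by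
    rw [Ideal.map_map, Ideal.map_map, hcomp]
  have hzi : ψ (algebraMap R (blowupAlgebra P (xx (Fin.succ i))) (xx (Fin.succ i))) =
      algebraMap (R ⧸ Ideal.span {u}) (blowupAlgebra (Ideal.span (Set.range zb))
        (Ideal.Quotient.mk (Ideal.span {u}) (z i))) (Ideal.Quotient.mk (Ideal.span {u}) (z i)) :=
    hψ (z i)
  rw [← h𝔟map, ← hzi]
  exact (colon_map_eq_map_of_eq_mul ψ (map_eq_span_mul_colon u z (Fin.succ i) h𝔟)
    (by rw [hzi]; exact algebraMap_mem_nonZeroDivisors_blowupAlgebra)).symm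

end ESide

end DepthOne

end Summit.ResolutionOfSingularities.ResolutionOfSingularities.Theorems

end
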